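import Literature.AlgebraicGeometry.Motives.ProjectiveSpaceCells
import Literature.AlgebraicGeometry.Resolution.ProjectiveSpaceRegular
import Literature.AlgebraicGeometry.Resolution.ProjectiveStrongResolution
import Literature.AlgebraicGeometry.Resolution.PrimeDivisorIdeals
import Summits.ResolutionOfSingularities.ResolutionOfSingularities.Theorems.EquisingularLiftEquisingularLiftNatRationalCarrierInfinite
import Mathlib.Algebra.MvPolynomial.Division
import Mathlib.RingTheory.Ideal.KrullsHeightTheorem
import HarnessLib

/-!
# [OURS · L1 W4.5(b) · EL♮(3) · WIDTH TABLE D17 «STAGE-0 TOWER BOOKKEEPING», engine (n5) piece] A STAGE-0 CARRIER FOR THE INVARIANT `Tower.InvB₄`: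
# a coordinate hyperplane of `ℙⁿ⁺²_k` is an infinite closed subset whose vanishing ideal is an effective Cartier divisor, so `𝟙 ℙⁿ⁺²` is its blow-up

res-L1-w45b-nose-w1 g7 (WIDTH seat D-0157 DOOR 1; desk RULING R82 (A) / R83 (3), my question (α)/(β) l.≈38540 answered by (α) in the kernel).
The T23-A‴ stage invariant ✓ `Tower.InvB₄ … F₉ Z₉ hZ₉ F₁₀ υ' …` (…NatTowerInvBFourDefs) opens with the carrier conjuncts `IsBlowup υ' 𝓘⟨Z₉⟩ ∧ Z₉.Infinite`;
door τ0 ✓ `ReachTowerNose₀` (…DefsE9) has NO nose blow-up, so the (n5) driver `reachTowerNose₀_of_fact` instantiates the motive with `F₉ := F₁₀ := ℙ³_k`,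
`υ' := 𝟙` and the carrier supplied here: ★ `Tower.exists_stage0Carrier k n : ∃ Z₉ hZ₉, IsBlowup (𝟙 ℙⁿ⁺²_k) 𝓘⟨Z₉⟩ ∧ Z₉.Infinite` — `Z₉ := closure {ζ}` for the
generic point `ζ` of the hyperplane `y₀ = 0` of the standard chart `Spec k[y₀,…,yₙ₊₁] ⟶ ℙⁿ⁺²_k` (✓ `ProjectiveSpaceCells.chartι`): `coheight ζ = ht (y₀) = 1` (Mathlib
`coheight_eq_of_isOpenImmersion`, `idealHeight_eq_coheight`, Krull), so `𝓘⟨closure {ζ}⟩ = primeDivisorIdeal ζ` is effective Cartier on the regular integral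
locally Noetherian `ℙⁿ⁺²_k` (✓ `isEffectiveCartier_primeDivisorIdeal_of_isRegular`, ✓ `isRegular_projectiveSpace`, ✓ `isIntegral_projectiveSpace`,
✓ `Kollar2007.isLocallyNoetherian_proj`) and ✓ `IsBlowup.id` applies; `closure {ζ}` contains the chart image of `V(y₀) ⊇ Spec k[y₁]` (the surjection
`k[y₀,…,yₙ₊₁] → k[t]`, `y₀ ↦ 0`, `yⱼ ↦ t`), which is infinite (✓ `infinite_spec_mvPolynomial_fin_one`).  Import-clean per hygiene (F-iv): no
`Literature/…/Hironaka2017/Proofs/…` import.  OURS; NOT a statement of any manuscript ([Hironaka2017] is a candidate under adjudication, nothing of it is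
asserted); AI-written, weaker than expert review.  DEF-FREE; no `sorry`; standard axioms.  `--kind proof --supports stmt-ResolutionOfSingularities-20148 --as helper`,
counted 0.  EL♮(3) is NOT proved here.  [folklore]
-/

set_option linter.dupNamespace false -- mandated namespace `Summit.<Summit>.<Problem>` of this single-conjunct summit

noncomputable section

open CategoryTheory AlgebraicGeometry TopologicalSpace Topology
open Literature.AlgebraicGeometry.Resolution
open AlgebraicGeometry.Scheme.IdealSheafData

namespace Summit.ResolutionOfSingularities.ResolutionOfSingularities.Cruxes.EquisingularLiftNat.Sections.Tower

/-- In `Spec k[y₀,…,yₙ₊₁]` the primes containing `y₀` form an infinite set (they contain the image of `Spec k[t]` under the surjection `y₀ ↦ 0`,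
`yⱼ ↦ t`). [folklore] -/
theorem infinite_setOf_X_zero_mem (k : Type) [Field k] (n : ℕ) :
    {𝔮 : ↥(Spec (CommRingCat.of (MvPolynomial (Fin (n + 2)) k))) | (MvPolynomial.X 0 : MvPolynomial (Fin (n + 2)) k) ∈ 𝔮.asIdeal}.Infinite := by
  classical
  set φ : MvPolynomial (Fin (n + 2)) k →ₐ[k] MvPolynomial (Fin 1) k :=
    MvPolynomial.aeval (fun i => if i = 0 then 0 else MvPolynomial.X 0) with hφ
  have hφ0 : φ (MvPolynomial.X 0) = 0 := by
    rw [hφ, MvPolynomial.aeval_X, if_pos rfl]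
  have hsurj : Function.Surjective φ.toRingHom := by
    intro q
    refine ⟨MvPolynomial.rename (fun _ => (1 : Fin (n + 2))) q, ?_⟩
    change φ (MvPolynomial.rename _ q) = q
    rw [hφ, MvPolynomial.aeval_rename]
    have hfun : ((fun i : Fin (n + 2) => if i = 0 then (0 : MvPolynomial (Fin 1) k) else MvPolynomial.X 0) ∘ fun _ : Fin 1 => (1 : Fin (n + 2))) =
        MvPolynomial.X := by
      funext j
      simp only [Function.comp_apply, one_ne_zero, if_false]
      rw [Subsingleton.elim j 0]
    rw [hfun, MvPolynomial.aeval_X_left_apply]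
  haveI : Infinite (PrimeSpectrum (MvPolynomial (Fin 1) k)) := infinite_spec_mvPolynomial_fin_one k
  have hinj : Function.Injective (PrimeSpectrum.comap φ.toRingHom) := PrimeSpectrum.comap_injective_of_surjective _ hsurj
  refine (Set.infinite_range_of_injective hinj).mono ?_
  rintro _ ⟨𝔮, rfl⟩
  change φ.toRingHom (MvPolynomial.X 0) ∈ 𝔮.asIdeal
  rw [AlgHom.toRingHom_eq_coe, AlgHom.coe_toRingHom, hφ0]
  exact Ideal.zero_mem _

/-- ★ **A stage-0 carrier for `Tower.InvB₄` on `ℙⁿ⁺²_k`**: an infinite closed subset `Z₉` (a coordinate hyperplane, as the closure of its generic point)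
whose vanishing ideal is an effective Cartier divisor, so that `𝟙 ℙⁿ⁺²_k` is the blow-up of `𝓘⟨Z₉⟩`. [OURS · L1 W4.5b · D17 engine (n5) piece; counted 0;
EL♮(3) NOT proved] -/
theorem exists_stage0Carrier (k : Type) [Field k] (n : ℕ) :
    ∃ (Z₉ : Set ↥((Literature.AlgebraicGeometry.Motives.projectiveSpace (n + 2) k).left)) (hZ₉ : IsClosed Z₉),
      IsBlowup (𝟙 (Literature.AlgebraicGeometry.Motives.projectiveSpace (n + 2) k).left) (vanishingIdeal (⟨Z₉, hZ₉⟩ : Closeds _)) ∧ Z₉.Infinite := by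
  classical
  haveI := isIntegral_projectiveSpace (n + 2) k
  haveI : IsLocallyNoetherian (Literature.AlgebraicGeometry.Motives.projectiveSpace (n + 2) k).left := Kollar2007.isLocallyNoetherian_proj
  have hXp : Prime (MvPolynomial.X 0 : MvPolynomial (Fin (n + 2)) k) := MvPolynomial.X_prime
  haveI hprime : (Ideal.span {(MvPolynomial.X 0 : MvPolynomial (Fin (n + 2)) k)}).IsPrime := (Ideal.span_singleton_prime hXp.ne_zero).mpr hXp
  -- the generic point of `V(y₀)` in the chart and its image `ζ` in `ℙⁿ⁺²`
  let ζ₀ : ↥(Spec (CommRingCat.of (MvPolynomial (Fin (n + 2)) k))) := ⟨Ideal.span {(MvPolynomial.X 0 : MvPolynomial (Fin (n + 2)) k)}, hprime⟩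
  let g := Literature.AlgebraicGeometry.Motives.ProjectiveSpaceCells.chartι k (n + 2) 0
  -- `coheight ζ = ht (y₀) = 1`
  have hcoh : Order.coheight (g.base ζ₀) = 1 := by
    refine (coheight_eq_of_isOpenImmersion (x := ζ₀) g).trans ?_
    rw [← idealHeight_eq_coheight (CommRingCat.of (MvPolynomial (Fin (n + 2)) k)) ζ₀]
    exact Ideal.height_span_singleton_eq_one_of_mem_nonZeroDivisors (mem_nonZeroDivisors_of_ne_zero hXp.ne_zero) hXp.not_unit
  refine ⟨closure {g.base ζ₀}, isClosed_closure, ?_, ?_⟩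
  · exact IsBlowup.id (isEffectiveCartier_primeDivisorIdeal_of_isRegular (isRegular_projectiveSpace (n + 2) k) hcoh)
  · -- `closure {ζ} ⊇ g '' {𝔮 ∋ y₀}`, an injective image of an infinite set
    refine ((infinite_setOf_X_zero_mem k n).image g.isOpenEmbedding.injective.injOn).mono ?_
    rintro _ ⟨𝔮, h𝔮, rfl⟩
    have hle : @LE.le (PrimeSpectrum (MvPolynomial (Fin (n + 2)) k)) _ ζ₀ 𝔮 := (Ideal.span_singleton_le_iff_mem _).mpr h𝔮
    have hsp : ζ₀ ⤳ 𝔮 := (PrimeSpectrum.le_iff_specializes ζ₀ 𝔮).mp hle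
    exact specializes_iff_mem_closure.mp (hsp.map g.continuous)

end Summit.ResolutionOfSingularities.ResolutionOfSingularities.Cruxes.EquisingularLiftNat.Sections.Tower

end
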